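import Summits.MatrixMultiplication.OmegaCensus.STPPZoo313Checker
import Summits.MatrixMultiplication.OmegaCensus.STPPZoo313TableP4

/-!
# ω-census (abelian STPP census): certification rows of the (3,13)@61 two-above zoo — leaf ranges, part 42

HONEST FRAMING (pub-omega census; verbatim): lottery ticket; floor = certified bounds/negative ranges.
Census STRUCTURE (seat pub-omega-stpp-1 gen 33, 2026-08-29), family (b2).  Kernel rows for `zoo313_61_of_rows` (`STPPZoo313Theorem.lean`): the depth-first
zoo search `zooGo 61 zooTbl61 …` (`STPPZoo313Checker.lean`) split along the prefix tree of the difference sequence; sibling ranges of one node are decided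
in one `decide +kernel` (≤ 15 000 leaves each); node theorems glue their children (`List.range'_append`).  Generator: HOME
`pub-omega-stpp-1-g33/code/gen_zoo_rows.py`.  Nothing here is progress on `ω`.
-/

namespace Summit.MatrixMultiplication.OmegaCensus.CubeNB.S2

/-- Zoo rows: node [1, 1, 7, 1, 1], children d ∈ [1, 12] (14868 leaves). [folklore] -/
theorem zooRow_r1_1_7_1_1_1_12 : ((List.range' 1 12).all fun d => cond (Nat.ble 2 d) (Nat.beq 2 0 || zooGo 61 zooTbl61 6 (48 - d) (2 - 1) (11 + d) (3591 ||| (1 <<< (11 + d))) ((11 + d) :: [11, 10, 9, 2, 1, 0])) (zooGo 61 zooTbl61 6 (48 - d) 2 (11 + d) (3591 ||| (1 <<< (11 + d))) ((11 + d) :: [11, 10, 9, 2, 1, 0]))) = true := by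
  decide +kernel

/-- Zoo rows: node [1, 1, 7, 1, 1], children d ∈ [13, 42] (2640 leaves). [folklore] -/
theorem zooRow_r1_1_7_1_1_13_30 : ((List.range' 13 30).all fun d => cond (Nat.ble 2 d) (Nat.beq 2 0 || zooGo 61 zooTbl61 6 (48 - d) (2 - 1) (11 + d) (3591 ||| (1 <<< (11 + d))) ((11 + d) :: [11, 10, 9, 2, 1, 0])) (zooGo 61 zooTbl61 6 (48 - d) 2 (11 + d) (3591 ||| (1 <<< (11 + d))) ((11 + d) :: [11, 10, 9, 2, 1, 0]))) = true := by
  decide +kernel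

/-- Zoo rows: node [1, 1, 7, 1], children d ∈ [2, 42] (5781 leaves). [folklore] -/
theorem zooRow_r1_1_7_1_2_41 : ((List.range' 2 41).all fun d => cond (Nat.ble 2 d) (Nat.beq 2 0 || zooGo 61 zooTbl61 7 (49 - d) (2 - 1) (10 + d) (1543 ||| (1 <<< (10 + d))) ((10 + d) :: [10, 9, 2, 1, 0])) (zooGo 61 zooTbl61 7 (49 - d) 2 (10 + d) (1543 ||| (1 <<< (10 + d))) ((10 + d) :: [10, 9, 2, 1, 0]))) = true := by
  decide +kernel

/-- Zoo rows: node [1, 1, 7], children d ∈ [2, 42] (6601 leaves). [folklore] -/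
theorem zooRow_r1_1_7_2_41 : ((List.range' 2 41).all fun d => cond (Nat.ble 2 d) (Nat.beq 2 0 || zooGo 61 zooTbl61 8 (50 - d) (2 - 1) (9 + d) (519 ||| (1 <<< (9 + d))) ((9 + d) :: [9, 2, 1, 0])) (zooGo 61 zooTbl61 8 (50 - d) 2 (9 + d) (519 ||| (1 <<< (9 + d))) ((9 + d) :: [9, 2, 1, 0]))) = true := by
  decide +kernel

/-- Zoo rows: node [1, 1, 8, 1, 1], children d ∈ [1, 17] (14981 leaves). [folklore] -/
theorem zooRow_r1_1_8_1_1_1_17 : ((List.range' 1 17).all fun d => cond (Nat.ble 2 d) (Nat.beq 2 0 || zooGo 61 zooTbl61 6 (47 - d) (2 - 1) (12 + d) (7175 ||| (1 <<< (12 + d))) ((12 + d) :: [12, 11, 10, 2, 1, 0])) (zooGo 61 zooTbl61 6 (47 - d) 2 (12 + d) (7175 ||| (1 <<< (12 + d))) ((12 + d) :: [12, 11, 10, 2, 1, 0]))) = true := by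
  decide +kernel

end Summit.MatrixMultiplication.OmegaCensus.CubeNB.S2
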